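import Literature.Topology.PlanarFoliations.HugPolygon
import Literature.Topology.PlanarFoliations.OrbitCycle
import Literature.Topology.PlanarFoliations.HugDegree
import Literature.Topology.PlanarFoliations.TraceStraight
import Literature.Topology.PlanarFoliations.TerminalPattern
import HarnessLib

/-!
# The hugging principle: an essential polygon in the limit set of a chain of essential leaves

Topic: Topology / PlanarFoliations. This file assembles the hugging step of the minimiser scheme
in Novikov's compact leaf theorem (the graph case of [CamachoLinsNeto1985, Ch. VII §2]): given
star data `D`, a bi-orientation, a transverse orientation, a compact leaf `K₀ = F.leaf x₀` whose
disc lies in the region `D.Ω`, and a strictly decreasing sequence of discs of **essential**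
compact leaves `K n` in the disc of `K₀` whose limit set `Dlim` has a domain frontier point and
only non-compact frontier leaves, **there is an essential simple separatrix polygon whose fill
lies in the limit set** (`StarData.hug`).

The proof chains the files of the hug walk:

* `HugState`/`HugWalk`/`HugStep`/`HugOrbit`: the frontier leaves of `Dlim` are separatrices
  joining punctures; from a frontier point, the hugged walk of separatrices turning to the side
  `s` on which the chain accumulates is good at every step and eventually periodic, a minimal
  period having distinct darts;
* `OrbitCycle`: the period is cycle data for `WalkBuild` (`cvtx`, `csx`), leaf-injective, the
  built walk turns to the side `s` and the chain crosses its first incoming star vertical;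
* `TraceStraight` + `HugDegree`: the planar trace of the built walk has a straight piece in a
  chart, so the winding argument shows that **the base loop of the walk fence is not
  null-homotopic** in the leaf space of `T` (`walkBase_not_null`);
* `CycleLeafPaths` + `HugPolygon`: hence the composite of the walk of pieces is not homotopic to
  a constant, and loop erasure extracts **a simple polygon with separatrices among the `csx`
  whose leaf loop is not null-homotopic** (`exists_polyCycle_of_not_null`);
* here: its separatrices are frontier leaves of `Dlim`, so its curve, hence its fill, lies in
  `Dlim` (`LeafJordan.fill_subset_discLeaf_of_range_subset_discLeaf` in every disc of the chain).

Feeding `hug` to `TerminalPattern.exists_terminal_pattern` gives the unconditional **existence of a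
terminal essential pattern** below an essential compact leaf (`exists_terminal_pattern'`).

## References

* C. Camacho, A. Lins Neto, *Geometric Theory of Foliations*, Birkhäuser (1985), Ch. VII §2
  [CamachoLinsNeto1985].
* S. P. Novikov, *Topology of foliations*, Trudy Moskov. Mat. Obšč. 14 (1965) [Novikov1965].
-/

noncomputable section

open Set Filter Function Metric unitInterval
open _root_.Topology
open Literature.Topology.FourManifolds Literature.Topology.FourManifolds.Foliation Literature.Topology.PlaneTopology

namespace Literature.Topology.PlanarFoliations

variable {X : Type*} [TopologicalSpace X] [T2Space X] [SecondCountableTopology X] [Nonempty X] {F : Foliation ℝ X} {ι : X → ℂ}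
variable {B : Type*} [NormedAddCommGroup B] [NormedSpace ℝ B] [LocallyConnectedSpace B] {M : Type*} [TopologicalSpace M]
  {T : Foliation B M} {g : ℂ → M}

namespace StarData

variable (D : StarData F ι T g) (hbi : IsBiOriented F) (hι : IsOpenEmbedding ι) (ho : F.IsTransverselyOriented)
  {x₀ : X} (hC₀ : IsCompact (discLeaf F ι x₀)) (hΩ : discLeaf F ι x₀ ⊆ D.Ω)

omit [NormedSpace ℝ B] [LocallyConnectedSpace B] in
/-- **The curve of a polygon whose separatrices lie in the limit set lies in the limit set.**
[folklore] -/
theorem PolyCycle.range_loop_subset_Dlim {C : Set ℂ} (Z : D.PolyCycle hbi C) (hC : IsCompact C) {K : ℕ → X}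
    (hK : ∀ n, IsCompact (F.leaf (K n))) (hleaf : ∀ i (q : F.Leaf (Z.sx i)), ι (Leaf.pt q) ∈ Dlim ι F K) :
    range (Z.loop hι hC) ⊆ Dlim ι F K := fun z hz ↦ by
  rcases Z.mem_range_loop_cases hι hC hz with ⟨i, rfl⟩ | ⟨i, y', hy', rfl⟩
  · have hωi : Z.vtx i ∈ omegaSet hbi ι (Z.sx i) := by rw [Z.omega i]; exact mem_singleton _
    exact omegaSet_subset_of_forall_mem (isCompact_Dlim hbi hι hK).isClosed (hleaf i) hωi
  · exact hleaf i (Leaf.mk y' hy')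

omit [NormedSpace ℝ B] [LocallyConnectedSpace B] in
/-- **The fill of a polygon whose separatrices lie in the limit set lies in the limit set.**
[folklore] -/
theorem PolyCycle.fill_subset_Dlim {C : Set ℂ} (Z : D.PolyCycle hbi C) (hC : IsCompact C) {K : ℕ → X}
    (hK : ∀ n, IsCompact (F.leaf (K n))) (hleaf : ∀ i (q : F.Leaf (Z.sx i)), ι (Leaf.pt q) ∈ Dlim ι F K) :
    Z.fill hι hC ⊆ Dlim ι F K := by
  have hrange := Z.range_loop_subset_Dlim D hbi hι hC hK hleaf
  intro z hz
  show z ∈ ⋂ n, discLeaf F ι (K n)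
  exact mem_iInter.2 fun n ↦ fill_subset_discLeaf_of_range_subset_discLeaf hbi hι (hK n) (hrange.trans (iInter_subset _ n)) hz

include ho hΩ in
/-- **The hugging principle.** For a strictly decreasing sequence of discs of essential compact
leaves `K n` in the disc of `K₀ ⊆ D.Ω`, whose limit set has a domain frontier point and only
non-compact frontier leaves, there is an essential simple separatrix polygon in the disc of `K₀`
whose fill lies in the limit set. [cite: CamachoLinsNeto1985, Ch. VII §2] -/
theorem hug (K : ℕ → X) (hK : ∀ n, IsCompact (F.leaf (K n))) (hdec : ∀ n, discLeaf F ι (K (n + 1)) ⊂ discLeaf F ι (K n))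
    (hess : ∀ n, ¬ ImageNull D.foliated (K n)) (hsub₀ : ∀ n, discLeaf F ι (K n) ⊆ discLeaf F ι x₀)
    (hfr : ∃ y, ι y ∈ frontier (Dlim ι F K)) (hnc : ∀ y, ι y ∈ frontier (Dlim ι F K) → ¬ IsCompact (F.leaf y)) :
    ∃ P : D.PolyPattern hbi hι x₀ hC₀, P.Z.fill hι hC₀ ⊆ Dlim ι F K := by
  have H : D.HugHyp hbi hι K := ⟨hK, hdec, (hsub₀ 0).trans hΩ, hnc⟩
  obtain ⟨y, hy⟩ := hfr
  -- the hugged walk from the frontier point `y`, its accumulation side and a minimal period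
  set d₀ : HugData H := HugState.canonData H ⟨y, hy⟩ with hd₀
  obtain ⟨s, hs, hcross⟩ := HugData.exists_cross d₀
  obtain ⟨c, p, hp, hper, hdist⟩ := HugData.exists_min_period ho d₀ hs hcross
  haveI : NeZero p := ⟨hp.ne'⟩
  have hsub : discLeaf F ι (K 0) ⊆ discLeaf F ι x₀ := hsub₀ 0
  -- the cycle data of the period and the built walk
  have hsx := HugData.csx_leaf_injective (s := s) (d₀ := d₀) (c := c) (p := p) hdist
  have hturn := HugData.walkJ_turn ho hs hcross hper hC₀ hsub
  have hℓ := D.continuous_toLeafSpace_walkℓ hι hC₀ (HugData.cvtx_mem s d₀ c p) (HugData.csx_mem s d₀ c p hsub)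
    (HugData.omega_csx s d₀ c p) (HugData.alpha_csx ho hs hcross hper)
  have hperJ := D.walkJ_period hι hC₀ (HugData.cvtx_mem s d₀ c p) (HugData.csx_mem s d₀ c p hsub)
    (HugData.omega_csx s d₀ c p) (HugData.alpha_csx ho hs hcross hper)
  -- a straight piece of the planar trace, and the winding argument
  have hωc := continuous_traceLoop ho hℓ hs hturn hperJ
  obtain ⟨e, he, e', he', P, a, hP⟩ := D.exists_straightPiece hι hC₀ (HugData.cvtx_mem s d₀ c p) (HugData.csx_mem s d₀ c p hsub)
    (HugData.omega_csx s d₀ c p) (HugData.alpha_csx ho hs hcross hper) hsx hωc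
  have hnn := walkBase_not_null ho hℓ hs hturn hbi hperJ he he' P hP hK hess (HugData.cross_walkJ ho hs hcross hper hC₀ hsub)
  -- the composite of the walk of pieces is not homotopic to a constant path
  have hessW : ¬ ∃ R : Path (D.pos (D.walkJ hι hC₀ (HugData.cvtx_mem s d₀ c p) (HugData.csx_mem s d₀ c p hsub)
      (HugData.omega_csx s d₀ c p) (HugData.alpha_csx ho hs hcross hper) 0).v) (D.pos (D.walkJ hι hC₀ (HugData.cvtx_mem s d₀ c p)
      (HugData.csx_mem s d₀ c p hsub) (HugData.omega_csx s d₀ c p) (HugData.alpha_csx ho hs hcross hper) p).v),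
      (∀ θ, R θ = D.pos (HugData.cvtx s d₀ c p (idx p 0))) ∧
        (D.polyWalk hι hC₀ (HugData.cvtx_mem s d₀ c p) (HugData.csx_mem s d₀ c p hsub) (HugData.omega_csx s d₀ c p)
          (HugData.alpha_csx ho hs hcross hper) p).comp.Homotopic R := by
    rintro ⟨R, hR, h⟩
    exact hnn (D.exists_base_null_of_comp_polyWalk hι hC₀ _ _ _ _ R hR h)
  -- loop erasure: an essential simple polygon with separatrices among the `csx`
  obtain ⟨Z, hZsx, hZess⟩ := D.exists_polyCycle_of_not_null hι hC₀ (HugData.cvtx_mem s d₀ c p) (HugData.csx_mem s d₀ c p hsub)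
    (HugData.omega_csx s d₀ c p) (HugData.alpha_csx ho hs hcross hper) hsx hessW
  refine ⟨⟨Z, hZess⟩, Z.fill_subset_Dlim D hbi hι hC₀ hK fun i q ↦ ?_⟩
  -- its separatrices are frontier leaves of the limit set
  obtain ⟨j, hj⟩ := hZsx i
  have hyD : ι (Z.sx i) ∈ Dlim ι F K := by
    rw [hj]; exact (isCompact_Dlim hbi hι hK).isClosed.frontier_subset (HugData.seq s d₀ (c + j)).st.hy
  exact image_leaf_subset_Dlim hbi hι hK hdec hyD ⟨Leaf.pt q, q.2, rfl⟩

include ho hΩ in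
/-- **A terminal essential pattern exists below an essential compact leaf whose disc lies in the
region**: either an essential polygon pattern or an essential compact leaf, with no essential
pattern (polygon or compact leaf) strictly inside its fill. [cite: CamachoLinsNeto1985, Ch. VII §2] -/
theorem exists_terminal_pattern' (hK₀ : IsCompact (F.leaf x₀)) (hess₀ : ¬ ImageNull D.foliated x₀) :
    (∃ P : D.PolyPattern hbi hι x₀ hC₀,
      (∀ Q : D.PolyPattern hbi hι x₀ hC₀, Q.Z.fill hι hC₀ ⊆ P.Z.fill hι hC₀ → Q.Z.fill hι hC₀ = P.Z.fill hι hC₀) ∧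
      (∀ Q : D.CompactPattern x₀, discLeaf F ι Q.y ⊆ P.Z.fill hι hC₀ → discLeaf F ι Q.y = P.Z.fill hι hC₀)) ∨
    (∃ K : D.CompactPattern x₀,
      (∀ Q : D.PolyPattern hbi hι x₀ hC₀, Q.Z.fill hι hC₀ ⊆ discLeaf F ι K.y → Q.Z.fill hι hC₀ = discLeaf F ι K.y) ∧
      (∀ Q : D.CompactPattern x₀, discLeaf F ι Q.y ⊆ discLeaf F ι K.y → discLeaf F ι Q.y = discLeaf F ι K.y)) :=
  D.exists_terminal_pattern hbi hι ho hK₀ hC₀ hΩ hess₀ fun K hK hdec hess hsub₀ hfr hnc ↦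
    D.hug hbi hι ho hC₀ hΩ K hK hdec hess hsub₀ hfr hnc

end StarData

end Literature.Topology.PlanarFoliations
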